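import Summits.AtomisticToContinuum.HydrodynamicLimit.Theorems.RelayRaceLocalityLightConeInLawStubTimeZero
import Literature.MathematicalPhysics.KineticTheory.HardSphereCanonicalTorus

/-!
# The core of the crux `LightConeInLaw` sits between two macroscopic statements
(stmt-AtomisticToContinuum-12500, line `Sketch`, `--supports`; route `RelayRaceLocality`,
sub-problem `HydrodynamicLimit`)

Sufficiency bookkeeping for the one open registered stub `stub_core` of the line `Sketch`
(`Cruxes/LightConeInLaw/Lines/Sketch.lean`, rev 6): the positive-time two-copy merging follows, by
pure logic over the line's merging lemma, from the conjunction of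

* **(HL-gen)** the packing-guarded hydrodynamic limit for GENERAL comparison families — for all
  continuous positive profiles there is `σ₀` such that for `0 < σ < σ₀`, every family of diameters
  `ε N → 0` and particle numbers `n N` with `n N · (ε N)³ → σ³`, every classical hs-Euler solution
  on `[0, T)` and every family of flows, if the canonical local Gibbs laws are probability measures
  with the law of large numbers at `t = 0` (`LLNAt … 0`), then at every `t < T` at which the packing
  guard `ρ σ³ < η₁` holds on `[0, t]` the law of large numbers holds at `t` (the body of
  `HydroLimitInBand`, stmt-AtomisticToContinuum-3093, for the comparison families of the crux; its
  near-constant short-time case is the route's `NearConstantShortTimeHL`); and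
* **(DoD)** reduced-cone uniqueness of classical hs-Euler solutions — two classical solutions, for
  reduced diameters `σ₁, σ₂`, whose REDUCED data `(ρσ³, U, Θ)` agree on `B(x₀, R)` at time `0` and
  whose fields obey the crux's guards on `[0, t]` agree in reduced units on `B(x₀, R − c t)` at time
  `t`, with `c = c(M)` (finite domain of dependence: both reduced triples solve the SAME symmetrisable
  system `∂ₜr + div(rU) = 0`, `∂ₜ(rU) + div(rU ⊗ U) + ∇(rΘ Z(r)) = 0`, …; Dafermos 2005 Ch. V),

written out as explicit hypotheses of `stub_core_of_hydroLimitGeneral_of_coneUniqueness` (nothing is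
asserted; no definition is introduced). Together with the landed NECESSITY
`Necessary.particleNumberContinuity_of_lightConeInLaw` (crux ⇒ PNC) this places the core exactly:
below the summit's conjunct generalised to comparison families plus a classical PDE fact, above
particle-number continuity. It is NOT the line's intended mechanism (which is microscopic locality,
card `count-sufficiency-reduction`); it records the macroscopic upper bound kernel-checked, so that
the planner can weigh the crux against `HydroLimitInBand`/`NearConstantShortTimeHL`.

* `merging_of_LLNAt` — the line's `stub_timeZero` at an arbitrary time `t`: two families whose
  empirical fields satisfy laws of large numbers at time `t` towards data agreeing in reduced units
  on `B(x₀, R')` have merging expectations of bounded `1`-Lipschitz functionals of the reduced fields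
  tested against any continuous `χ` vanishing off `B(x₀, R')` (both converge to `F` of the common
  limit, `TimeZero.tendsto_integral_reducedTriple`).
* `stub_core_of_hydroLimitGeneral_of_coneUniqueness` — (HL-gen) → (DoD) → the registered signature
  of `stub_core`, verbatim.
-/

namespace Summit.AtomisticToContinuum.HydrodynamicLimit.Theorems.LightConeInLawSketch.Sandwich

open scoped BigOperators Topology Classical ENNReal
open Filter Set MeasureTheory
open Literature.MathematicalPhysics.KineticTheory Literature.Analysis.FluidPDE

noncomputable section

/-- **Merging at time `t` from two laws of large numbers at time `t`** (the line's `stub_timeZero`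
with `0` replaced by `t`): if the empirical fields of the two gases at time `t` converge in
probability to `(ρᵢ, ρᵢUᵢ, Eᵢ)` and the reduced data `(ρσ³, U, Θ)` agree on `B(x₀, R')`, then for
every continuous `χ` vanishing off `B(x₀, R')` and every `1`-Lipschitz `F` bounded by `1` the two
expectations of `F` of the reduced fields tested against `χ` merge — both tend to `F` of the common
deterministic limit. -/
theorem merging_of_LLNAt {n₁ n₂ : ℕ → ℕ} {ε₁ ε₂ : ℕ → ℝ} {σ₁ σ₂ : ℝ} (hσ₁ : 0 < σ₁) (hσ₂ : 0 < σ₂)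
    (Φ₁ : (N : ℕ) → HardSphereFlow G3 (ε₁ N) (n₁ N))
    (Φ₂ : (N : ℕ) → HardSphereFlow G3 (ε₂ N) (n₂ N))
    (P₁ : (N : ℕ) → Measure (Config (n₁ N) (Fin 3) T3))
    (P₂ : (N : ℕ) → Measure (Config (n₂ N) (Fin 3) T3))
    (hP₁ : ∀ N, IsProbabilityMeasure (P₁ N)) (hP₂ : ∀ N, IsProbabilityMeasure (P₂ N))
    {ρ₁ Θ₁ ρ₂ Θ₂ : T3 → ℝ} {U₁ U₂ : T3 → V3} {t : ℝ}
    (hL₁ : LLNAt n₁ P₁ Φ₁ ρ₁ U₁ Θ₁ t) (hL₂ : LLNAt n₂ P₂ Φ₂ ρ₂ U₂ Θ₂ t)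
    {x₀ : T3} {R' : ℝ}
    (hagree : ∀ x, Torus.euclidDist x x₀ < R' →
      ρ₁ x * σ₁ ^ 3 = ρ₂ x * σ₂ ^ 3 ∧ U₁ x = U₂ x ∧ Θ₁ x = Θ₂ x)
    {χ : T3 → ℝ} (hχ : Continuous χ) (hsupp : ∀ x, R' ≤ Torus.euclidDist x x₀ → χ x = 0)
    (F : ℝ × V3 × ℝ → ℝ) (hF : LipschitzWith 1 F) (hFb : ∀ p, |F p| ≤ 1) :
    Tendsto (fun N =>
      (∫ z, F (σ₁ ^ 3 * empiricalDensityField ((Φ₁ N).flow t z) χ,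
          (σ₁ ^ 3) • empiricalMomentumField ((Φ₁ N).flow t z) χ,
          σ₁ ^ 3 * empiricalEnergyField ((Φ₁ N).flow t z) χ) ∂(P₁ N)) -
      ∫ z, F (σ₂ ^ 3 * empiricalDensityField ((Φ₂ N).flow t z) χ,
          (σ₂ ^ 3) • empiricalMomentumField ((Φ₂ N).flow t z) χ,
          σ₂ ^ 3 * empiricalEnergyField ((Φ₂ N).flow t z) χ) ∂(P₂ N)) atTop (𝓝 0) := by
  have hlim₁ := TimeZero.tendsto_integral_reducedTriple P₁ hP₁ Φ₁ ρ₁ Θ₁ U₁ t hL₁ hσ₁ hχ F hF hFb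
  have hlim₂ := TimeZero.tendsto_integral_reducedTriple P₂ hP₂ Φ₂ ρ₂ Θ₂ U₂ t hL₂ hσ₂ hχ F hF hFb
  -- the pointwise agreement of the reduced integrands
  have hptρ : ∀ x, σ₁ ^ 3 * (χ x * ρ₁ x) = σ₂ ^ 3 * (χ x * ρ₂ x) := by
    intro x
    rcases lt_or_ge (Torus.euclidDist x x₀) R' with hx | hx
    · have h := (hagree x hx).1
      calc σ₁ ^ 3 * (χ x * ρ₁ x) = χ x * (ρ₁ x * σ₁ ^ 3) := by ring
        _ = χ x * (ρ₂ x * σ₂ ^ 3) := by rw [h]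
        _ = σ₂ ^ 3 * (χ x * ρ₂ x) := by ring
    · simp [hsupp x hx]
  have hptU : ∀ x, (σ₁ ^ 3) • ((χ x * ρ₁ x) • U₁ x) = (σ₂ ^ 3) • ((χ x * ρ₂ x) • U₂ x) := by
    intro x
    rcases lt_or_ge (Torus.euclidDist x x₀) R' with hx | hx
    · obtain ⟨-, hU, -⟩ := hagree x hx
      rw [smul_smul, smul_smul, hptρ x, hU]
    · simp [hsupp x hx]
  have hptE : ∀ x, σ₁ ^ 3 * (χ x * totalEnergyDensity (ρ₁ x) (U₁ x) (Θ₁ x)) =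
      σ₂ ^ 3 * (χ x * totalEnergyDensity (ρ₂ x) (U₂ x) (Θ₂ x)) := by
    intro x
    rcases lt_or_ge (Torus.euclidDist x x₀) R' with hx | hx
    · obtain ⟨-, hU, hΘ⟩ := hagree x hx
      simp only [totalEnergyDensity]
      calc σ₁ ^ 3 * (χ x * (ρ₁ x * (‖U₁ x‖ ^ 2 / 2 + 3 / 2 * Θ₁ x)))
          = σ₁ ^ 3 * (χ x * ρ₁ x) * (‖U₁ x‖ ^ 2 / 2 + 3 / 2 * Θ₁ x) := by ring
        _ = σ₂ ^ 3 * (χ x * ρ₂ x) * (‖U₂ x‖ ^ 2 / 2 + 3 / 2 * Θ₂ x) := by rw [hptρ x, hU, hΘ]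
        _ = σ₂ ^ 3 * (χ x * (ρ₂ x * (‖U₂ x‖ ^ 2 / 2 + 3 / 2 * Θ₂ x))) := by ring
    · simp [hsupp x hx]
  -- hence the two deterministic limits coincide
  have hLeq : (σ₁ ^ 3 * ∫ x, χ x * ρ₁ x, (σ₁ ^ 3) • ∫ x, (χ x * ρ₁ x) • U₁ x,
        σ₁ ^ 3 * ∫ x, χ x * totalEnergyDensity (ρ₁ x) (U₁ x) (Θ₁ x)) =
      (σ₂ ^ 3 * ∫ x, χ x * ρ₂ x, (σ₂ ^ 3) • ∫ x, (χ x * ρ₂ x) • U₂ x,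
        σ₂ ^ 3 * ∫ x, χ x * totalEnergyDensity (ρ₂ x) (U₂ x) (Θ₂ x)) := by
    refine Prod.ext ?_ (Prod.ext ?_ ?_)
    · change σ₁ ^ 3 * ∫ x, χ x * ρ₁ x = σ₂ ^ 3 * ∫ x, χ x * ρ₂ x
      rw [← integral_const_mul, ← integral_const_mul]
      exact integral_congr_ae (Eventually.of_forall hptρ)
    · change (σ₁ ^ 3) • ∫ x, (χ x * ρ₁ x) • U₁ x = (σ₂ ^ 3) • ∫ x, (χ x * ρ₂ x) • U₂ x
      rw [← integral_smul, ← integral_smul]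
      exact integral_congr_ae (Eventually.of_forall hptU)
    · change σ₁ ^ 3 * ∫ x, χ x * totalEnergyDensity (ρ₁ x) (U₁ x) (Θ₁ x) =
        σ₂ ^ 3 * ∫ x, χ x * totalEnergyDensity (ρ₂ x) (U₂ x) (Θ₂ x)
      rw [← integral_const_mul, ← integral_const_mul]
      exact integral_congr_ae (Eventually.of_forall hptE)
  rw [hLeq] at hlim₁
  have h := hlim₁.sub hlim₂
  rwa [sub_self] at h

/-- **The core below the generalised conjunct.** If (HL-gen) the packing-guarded hydrodynamic limit
holds for general comparison families `(ε N, n N)` with `n N · (ε N)³ → σ³`, `ε N → 0`, and (DoD)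
classical hs-Euler solutions whose reduced data agree on `B(x₀, R)` at time `0` agree in reduced
units on `B(x₀, R − c t)` at time `t` under the guards (`c = c(M)`), then the registered stub
`stub_core` of the line `Sketch` holds (its signature is the conclusion, verbatim). Proof: both
gases satisfy the law of large numbers at time `t` — gas 1 as the family `ε N = hsDiameter σ₁ N`,
`n N = N + 1` at reduced density `σ₁`, gas 2 as the family `ε N = hsDiameter σ₁ N`, `n N = n₂ N` at
reduced density `σ₂` — towards Euler data that agree in reduced units on `B(x₀, R − c t)` by (DoD);
`merging_of_LLNAt` finishes. The thresholds are `η₀ := min η₁ η₂`, `c := c(M)` of (DoD),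
`σ₀ := min (σ₀(a₁,θ₁,u₁)) (σ₀(a₂,θ₂,u₂))` of (HL-gen); the identification hypotheses, `0 < t` and
`0 < R − c t` of the stub are not needed. -/
theorem stub_core_of_hydroLimitGeneral_of_coneUniqueness :
    (∃ η₁ : ℝ, 0 < η₁ ∧
      ∀ (a θ : T3 → ℝ) (u : T3 → V3), Continuous a → Continuous θ → Continuous u →
        (∀ x, 0 < a x) → (∀ x, 0 < θ x) →
      ∃ σ₀ : ℝ, 0 < σ₀ ∧ ∀ σ : ℝ, 0 < σ → σ < σ₀ →
      ∀ (ε : ℕ → ℝ) (n : ℕ → ℕ), (∀ N, 0 < ε N) → Tendsto ε atTop (𝓝 0) →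
        Tendsto (fun N => (n N : ℝ) * ε N ^ 3) atTop (𝓝 (σ ^ 3)) →
      ∀ (T : ℝ) (ρ Θ : ℝ → T3 → ℝ) (U : ℝ → T3 → V3), IsHardSphereEulerSolution σ T ρ U Θ →
      ∀ Φ : (N : ℕ) → HardSphereFlow G3 (ε N) (n N),
      (∀ N, IsProbabilityMeasure
        (particleLaw (Φ N) (canonicalDensity G3 (ε N) (n N) (localGibbsProfile a u θ)))) →
      LLNAt n (fun N => particleLaw (Φ N)
        (canonicalDensity G3 (ε N) (n N) (localGibbsProfile a u θ))) Φ (ρ 0) (U 0) (Θ 0) 0 →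
      ∀ t : ℝ, 0 ≤ t → t < T → (∀ s ∈ Set.Icc 0 t, ∀ x, ρ s x * σ ^ 3 < η₁) →
      LLNAt n (fun N => particleLaw (Φ N)
        (canonicalDensity G3 (ε N) (n N) (localGibbsProfile a u θ))) Φ (ρ t) (U t) (Θ t) t) →
    (∃ η₂ : ℝ, 0 < η₂ ∧ ∀ M : ℝ, 0 < M → ∃ c : ℝ, 0 < c ∧
      ∀ (σ₁ σ₂ : ℝ), 0 < σ₁ → 0 < σ₂ →
      ∀ (T₁ T₂ : ℝ) (ρ₁ Θ₁ ρ₂ Θ₂ : ℝ → T3 → ℝ) (U₁ U₂ : ℝ → T3 → V3),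
        IsHardSphereEulerSolution σ₁ T₁ ρ₁ U₁ Θ₁ → IsHardSphereEulerSolution σ₂ T₂ ρ₂ U₂ Θ₂ →
      ∀ t : ℝ, 0 ≤ t → t < T₁ → t < T₂ →
        (∀ s ∈ Set.Icc 0 t, ∀ x, ρ₁ s x * σ₁ ^ 3 < η₂ ∧ Θ₁ s x ≤ M ∧ ‖U₁ s x‖ ≤ M ∧
          ρ₂ s x * σ₂ ^ 3 < η₂ ∧ Θ₂ s x ≤ M ∧ ‖U₂ s x‖ ≤ M) →
      ∀ (x₀ : T3) (R : ℝ),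
        (∀ x, Torus.euclidDist x x₀ < R →
          ρ₁ 0 x * σ₁ ^ 3 = ρ₂ 0 x * σ₂ ^ 3 ∧ U₁ 0 x = U₂ 0 x ∧ Θ₁ 0 x = Θ₂ 0 x) →
      ∀ x, Torus.euclidDist x x₀ < R - c * t →
        ρ₁ t x * σ₁ ^ 3 = ρ₂ t x * σ₂ ^ 3 ∧ U₁ t x = U₂ t x ∧ Θ₁ t x = Θ₂ t x) →
    ∃ η₀ : ℝ, 0 < η₀ ∧ ∀ M : ℝ, 0 < M → ∃ c : ℝ, 0 < c ∧
    ∀ (a₁ θ₁ a₂ θ₂ : T3 → ℝ) (u₁ u₂ : T3 → V3), Continuous a₁ → Continuous θ₁ → Continuous u₁ →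
      Continuous a₂ → Continuous θ₂ → Continuous u₂ → (∀ x, 0 < a₁ x) → (∀ x, 0 < θ₁ x) →
      (∀ x, 0 < a₂ x) → (∀ x, 0 < θ₂ x) →
    ∃ σ₀ : ℝ, 0 < σ₀ ∧ ∀ (σ₁ σ₂ : ℝ), 0 < σ₁ → σ₁ < σ₀ → 0 < σ₂ → σ₂ < σ₀ →
    ∀ n₂ : ℕ → ℕ, Tendsto (fun N => (n₂ N : ℝ) * hsDiameter σ₁ N ^ 3) atTop (𝓝 (σ₂ ^ 3)) →
    ∀ (T₁ T₂ : ℝ) (ρ₁ Θ₁ ρ₂ Θ₂ : ℝ → T3 → ℝ) (U₁ U₂ : ℝ → T3 → V3),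
      IsHardSphereEulerSolution σ₁ T₁ ρ₁ U₁ Θ₁ → IsHardSphereEulerSolution σ₂ T₂ ρ₂ U₂ Θ₂ →
    ∀ (Φ₁ : (N : ℕ) → HardSphereFlow G3 (hsDiameter σ₁ N) (N + 1))
      (Φ₂ : (N : ℕ) → HardSphereFlow G3 (hsDiameter σ₁ N) (n₂ N)),
    (∀ N, IsProbabilityMeasure (localGibbsLaw σ₁ a₁ u₁ θ₁ N (Φ₁ N))) →
    (∀ N, IsProbabilityMeasure (particleLaw (Φ₂ N)
      (canonicalDensity G3 (hsDiameter σ₁ N) (n₂ N) (localGibbsProfile a₂ u₂ θ₂)))) →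
    TendstoHydroFieldsAt (fun N => localGibbsLaw σ₁ a₁ u₁ θ₁ N (Φ₁ N)) Φ₁ ρ₁ U₁ Θ₁ 0 →
    LLNAt n₂ (fun N => particleLaw (Φ₂ N)
      (canonicalDensity G3 (hsDiameter σ₁ N) (n₂ N) (localGibbsProfile a₂ u₂ θ₂))) Φ₂
      (ρ₂ 0) (U₂ 0) (Θ₂ 0) 0 →
    (∀ x, U₁ 0 x = u₁ x ∧ Θ₁ 0 x = θ₁ x) → (∀ x, U₂ 0 x = u₂ x ∧ Θ₂ 0 x = θ₂ x) →
    ∀ t : ℝ, 0 < t → t < T₁ → t < T₂ →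
      (∀ s ∈ Set.Icc 0 t, ∀ x, ρ₁ s x * σ₁ ^ 3 < η₀ ∧ Θ₁ s x ≤ M ∧ ‖U₁ s x‖ ≤ M ∧
        ρ₂ s x * σ₂ ^ 3 < η₀ ∧ Θ₂ s x ≤ M ∧ ‖U₂ s x‖ ≤ M) →
    ∀ (x₀ : T3) (R : ℝ), 0 < R - c * t →
      (∀ x, Torus.euclidDist x x₀ < R →
        ρ₁ 0 x * σ₁ ^ 3 = ρ₂ 0 x * σ₂ ^ 3 ∧ U₁ 0 x = U₂ 0 x ∧ Θ₁ 0 x = Θ₂ 0 x) →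
    ∀ χ : T3 → ℝ, Continuous χ → (∀ x, R - c * t ≤ Torus.euclidDist x x₀ → χ x = 0) →
    ∀ F : ℝ × V3 × ℝ → ℝ, LipschitzWith 1 F → (∀ p, |F p| ≤ 1) →
      Tendsto (fun N =>
        (∫ z, F (σ₁ ^ 3 * empiricalDensityField ((Φ₁ N).flow t z) χ,
            (σ₁ ^ 3) • empiricalMomentumField ((Φ₁ N).flow t z) χ,
            σ₁ ^ 3 * empiricalEnergyField ((Φ₁ N).flow t z) χ) ∂(localGibbsLaw σ₁ a₁ u₁ θ₁ N (Φ₁ N))) -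
        ∫ z, F (σ₂ ^ 3 * empiricalDensityField ((Φ₂ N).flow t z) χ,
            (σ₂ ^ 3) • empiricalMomentumField ((Φ₂ N).flow t z) χ,
            σ₂ ^ 3 * empiricalEnergyField ((Φ₂ N).flow t z) χ) ∂(particleLaw (Φ₂ N)
              (canonicalDensity G3 (hsDiameter σ₁ N) (n₂ N) (localGibbsProfile a₂ u₂ θ₂)))) atTop (𝓝 0) := by
  intro hHL hDoD
  obtain ⟨η₁, hη₁, HL⟩ := hHL
  obtain ⟨η₂, hη₂, HD⟩ := hDoD
  refine ⟨min η₁ η₂, lt_min hη₁ hη₂, fun M hM => ?_⟩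
  obtain ⟨c, hc, HDc⟩ := HD M hM
  refine ⟨c, hc, ?_⟩
  intro a₁ θ₁ a₂ θ₂ u₁ u₂ ha₁ hθ₁ hu₁ ha₂ hθ₂ hu₂ ha₁0 hθ₁0 ha₂0 hθ₂0
  obtain ⟨s₁, hs₁, HL₁⟩ := HL a₁ θ₁ u₁ ha₁ hθ₁ hu₁ ha₁0 hθ₁0
  obtain ⟨s₂, hs₂, HL₂⟩ := HL a₂ θ₂ u₂ ha₂ hθ₂ hu₂ ha₂0 hθ₂0
  refine ⟨min s₁ s₂, lt_min hs₁ hs₂, ?_⟩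
  intro σ₁ σ₂ hσ₁ hσ₁' hσ₂ hσ₂' n₂ hn₂ T₁ T₂ ρ₁ Θ₁ ρ₂ Θ₂ U₁ U₂ hsol₁ hsol₂ Φ₁ Φ₂ hP₁ hP₂
    hL₁ hL₂ _ _ t ht htT₁ htT₂ hguard x₀ R _ hagree χ hχ hsupp F hF hFb
  have hε0 : ∀ N, 0 < hsDiameter σ₁ N := fun N => hsDiameter_pos hσ₁ N
  have hεt : Tendsto (fun N => hsDiameter σ₁ N) atTop (𝓝 0) := tendsto_hsDiameter σ₁
  -- gas 1: the law of large numbers at time `t` (family `ε N = hsDiameter σ₁ N`, `n N = N + 1`)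
  have hn₁ : Tendsto (fun N : ℕ => (((fun N => N + 1) N : ℕ) : ℝ) * hsDiameter σ₁ N ^ 3) atTop
      (𝓝 (σ₁ ^ 3)) := by
    have : (fun N : ℕ => (((fun N => N + 1) N : ℕ) : ℝ) * hsDiameter σ₁ N ^ 3) =
        fun _ => σ₁ ^ 3 := funext fun N => succ_mul_hsDiameter_pow_three σ₁ N
    rw [this]
    exact tendsto_const_nhds
  have hguard₁ : ∀ s ∈ Set.Icc 0 t, ∀ x, ρ₁ s x * σ₁ ^ 3 < η₁ := fun s hs x =>
    (hguard s hs x).1.trans_le (min_le_left _ _)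
  have hguard₂ : ∀ s ∈ Set.Icc 0 t, ∀ x, ρ₂ s x * σ₂ ^ 3 < η₁ := fun s hs x =>
    (hguard s hs x).2.2.2.1.trans_le (min_le_left _ _)
  have hLt₁ : LLNAt (fun N => N + 1) (fun N => localGibbsLaw σ₁ a₁ u₁ θ₁ N (Φ₁ N)) Φ₁
      (ρ₁ t) (U₁ t) (Θ₁ t) t :=
    HL₁ σ₁ hσ₁ (hσ₁'.trans_le (min_le_left _ _)) (fun N => hsDiameter σ₁ N) (fun N => N + 1)
      hε0 hεt hn₁ T₁ ρ₁ Θ₁ U₁ hsol₁ Φ₁ hP₁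
      ((tendstoHydroFieldsAt_iff_LLNAt _ Φ₁ ρ₁ U₁ Θ₁ 0).1 hL₁) t ht.le htT₁ hguard₁
  -- gas 2: the law of large numbers at time `t` (family `ε N = hsDiameter σ₁ N`, `n N = n₂ N`)
  have hLt₂ : LLNAt n₂ (fun N => particleLaw (Φ₂ N)
      (canonicalDensity G3 (hsDiameter σ₁ N) (n₂ N) (localGibbsProfile a₂ u₂ θ₂))) Φ₂
      (ρ₂ t) (U₂ t) (Θ₂ t) t :=
    HL₂ σ₂ hσ₂ (hσ₂'.trans_le (min_le_right _ _)) (fun N => hsDiameter σ₁ N) n₂ hε0 hεt hn₂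
      T₂ ρ₂ Θ₂ U₂ hsol₂ Φ₂ hP₂ hL₂ t ht.le htT₂ hguard₂
  -- the reduced Euler data agree in the cone at time `t`
  have hguard' : ∀ s ∈ Set.Icc 0 t, ∀ x, ρ₁ s x * σ₁ ^ 3 < η₂ ∧ Θ₁ s x ≤ M ∧ ‖U₁ s x‖ ≤ M ∧
      ρ₂ s x * σ₂ ^ 3 < η₂ ∧ Θ₂ s x ≤ M ∧ ‖U₂ s x‖ ≤ M := by
    intro s hs x
    obtain ⟨h1, h2, h3, h4, h5, h6⟩ := hguard s hs x
    exact ⟨h1.trans_le (min_le_right _ _), h2, h3, h4.trans_le (min_le_right _ _), h5, h6⟩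
  have hagree_t : ∀ x, Torus.euclidDist x x₀ < R - c * t →
      ρ₁ t x * σ₁ ^ 3 = ρ₂ t x * σ₂ ^ 3 ∧ U₁ t x = U₂ t x ∧ Θ₁ t x = Θ₂ t x :=
    HDc σ₁ σ₂ hσ₁ hσ₂ T₁ T₂ ρ₁ Θ₁ ρ₂ Θ₂ U₁ U₂ hsol₁ hsol₂ t ht.le htT₁ htT₂ hguard' x₀ R hagree
  exact merging_of_LLNAt hσ₁ hσ₂ Φ₁ Φ₂ _ _ hP₁ hP₂ hLt₁ hLt₂ hagree_t hχ hsupp F hF hFb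

end

end Summit.AtomisticToContinuum.HydrodynamicLimit.Theorems.LightConeInLawSketch.Sandwich
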